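import Summits.AtomisticToContinuum.HydrodynamicLimit.Theorems.AntiMazurCoboundariesCellForecastPressureDecayTorusGibbsInvariant
import HarnessLib

/-!
# The torus hard-sphere flow preserves the torus canonical law (corollary file of stub
# `stub_torusGibbsInvariant`, line `entropy-ball-invariant-states` of crux
# `AntiMazurCoboundaries.CellForecastPressureDecay`, stmt-AtomisticToContinuum-13915)

`stub_torusGibbsInvariant` (landed, `…TorusGibbsInvariant.lean`) gives the invariance of
`torusGibbs ε n Φ` under `Φ.flow t` as an equality of push-forwards. The consumers on the line (the
Krylov–Bogoliubov average of the duality stub, the almost-invariance bookkeeping of the closure stub, the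
dynamic comparison of the torus reduction) use it in the bundled Mathlib form `MeasurePreserving`, with its
`lintegral_comp` / `integral_comp`-type API, and as the transport identities for integrals. This file records
exactly these corollaries (registered helper stub `stub_torusGibbsMeasurePreserving`).
-/

noncomputable section

open MeasureTheory
open scoped ENNReal

namespace Summit.AtomisticToContinuum.HydrodynamicLimit.Theorems.EntropyBall

/-- **`Φ_t` preserves the torus canonical Gibbs law** (every diameter `ε`, particle number `n`, torus
hard-sphere flow `Φ`, time `t`): the bundled form of `map_flow_torusGibbs`. -/
theorem measurePreserving_flow_torusGibbs (ε : ℝ) (n : ℕ) (Φ : TorusFlow ε n) (t : ℝ) :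
    MeasurePreserving (Φ.flow t) (torusGibbs ε n Φ) (torusGibbs ε n Φ) :=
  ⟨Φ.measurable_flow t, map_flow_torusGibbs ε n Φ t⟩

/-- Transport of Lebesgue integrals along the flow: `∫⁻ F (Φ_t z) dG = ∫⁻ F dG` for measurable `F`. -/
theorem lintegral_comp_flow_torusGibbs (ε : ℝ) (n : ℕ) (Φ : TorusFlow ε n) (t : ℝ)
    {F : TorusPhase n → ℝ≥0∞} (hF : Measurable F) :
    ∫⁻ z, F (Φ.flow t z) ∂(torusGibbs ε n Φ) = ∫⁻ z, F z ∂(torusGibbs ε n Φ) :=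
  (measurePreserving_flow_torusGibbs ε n Φ t).lintegral_comp hF

/-- Transport of Bochner integrals along the flow: `∫ F (Φ_t z) dG = ∫ F dG` for every `F`
(a.e.-strongly measurable or not: `integral_map` covers the measurable case and both sides are the junk
value `0` otherwise is NOT claimed — we assume `AEStronglyMeasurable F G`). -/
theorem integral_comp_flow_torusGibbs (ε : ℝ) (n : ℕ) (Φ : TorusFlow ε n) (t : ℝ)
    {F : TorusPhase n → ℝ} (hF : AEStronglyMeasurable F (torusGibbs ε n Φ)) :
    ∫ z, F (Φ.flow t z) ∂(torusGibbs ε n Φ) = ∫ z, F z ∂(torusGibbs ε n Φ) := by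
  have h := integral_map (μ := torusGibbs ε n Φ) (Φ.measurable_flow t).aemeasurable (f := F)
    (by rwa [map_flow_torusGibbs ε n Φ t])
  rw [map_flow_torusGibbs ε n Φ t] at h
  exact h.symm

/-- The flow preserves the mass of every measurable set: `G(Φ_t⁻¹ B) = G(B)`. -/
theorem torusGibbs_preimage_flow (ε : ℝ) (n : ℕ) (Φ : TorusFlow ε n) (t : ℝ)
    {B : Set (TorusPhase n)} (hB : MeasurableSet B) :
    torusGibbs ε n Φ (Φ.flow t ⁻¹' B) = torusGibbs ε n Φ B :=
  (measurePreserving_flow_torusGibbs ε n Φ t).measure_preimage hB.nullMeasurableSet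

/-- **Registered helper stub `stub_torusGibbsMeasurePreserving`** (S2b track of the line): the bundled
measure preservation and the two transport identities. -/
theorem stub_torusGibbsMeasurePreserving :
    (∀ (ε : ℝ) (n : ℕ) (Φ : TorusFlow ε n) (t : ℝ),
      MeasurePreserving (Φ.flow t) (torusGibbs ε n Φ) (torusGibbs ε n Φ)) ∧
    (∀ (ε : ℝ) (n : ℕ) (Φ : TorusFlow ε n) (t : ℝ) (F : TorusPhase n → ℝ≥0∞), Measurable F →
      ∫⁻ z, F (Φ.flow t z) ∂(torusGibbs ε n Φ) = ∫⁻ z, F z ∂(torusGibbs ε n Φ)) ∧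
    (∀ (ε : ℝ) (n : ℕ) (Φ : TorusFlow ε n) (t : ℝ) (B : Set (TorusPhase n)), MeasurableSet B →
      torusGibbs ε n Φ (Φ.flow t ⁻¹' B) = torusGibbs ε n Φ B) :=
  ⟨measurePreserving_flow_torusGibbs, fun ε n Φ t _ hF => lintegral_comp_flow_torusGibbs ε n Φ t hF,
    fun ε n Φ t _ hB => torusGibbs_preimage_flow ε n Φ t hB⟩

end Summit.AtomisticToContinuum.HydrodynamicLimit.Theorems.EntropyBall

end
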